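import Summits.QuantumFields.YangMills.Theorems.TwistedTraceScaling.Negative.TwoLoopCalibrationGuards
import Summits.QuantumFields.YangMills.Theorems.LuscherReductionTwistedTraceScalingTrackNonVacuity
import HarnessLib

/-!
# `TwistedTraceScaling` (crux stmt-QuantumFields-20203, route `LuscherReduction`, skeleton «twolattice» REV 3):
# negative-side support VIII — design facts for the ROUND-2 crux-idea re-cut CMP-SW («time-exact-compression» g2, the sandwich re-cut of CMP-2LOOP)
# (refuter crux-disprover seat, cycle 7; this file does NOT refute the crux or any stub)

HONEST FRAMING: `TwistedTraceScaling` is a femto-rung (R2b1) crux of a CONDITIONAL reduction route; nothing here is a mass-gap,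
infinite-volume or Clay statement.  Objects are the tree's (`TraceDoor.traceRatio/femtoSteps`, `InFemtoWindow`, `luscherLambda`,
`TwoLattice.flowInvSq/calLambda/Stmt.twoLoopLawH/twoLoopStepBal`).  The statement text examined is `Stmt.cmpSandwich` (CMP-SW) of the round-2 typed
sketch `Cruxes/TwistedTraceScaling/SketchIdeator1g2.lean`; it is SPELLED OUT INLINE below with the tree abbreviations (no `Cruxes` import, no
proposition defined under `Summits/`).

Results.
* `cmpSandwich_iff_withoutBeta1GeOne`: in CMP-SW the conjunct `1 ≤ β₁ ∧` is REMOVABLE — it follows from `1/(4lam³) ≤ x̂`, the band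
  `|x̂ − 2β₁| ≤ δ·2β₁` and `lam ≤ 1/(2(1+δ))` (support VI, `R3.one_le_beta1_of_calibrated`); the two texts are equivalent outright, exactly as support VI
  showed for CMP-2LOOP (`R3.cmpTwoLoop_iff_withoutBeta1GeOne`).  Design information: the two-root pathology of the label stays confined to TRACK.
* `cmpSandwich_antecedents_inhabited`: for EVERY lawful calibrator `φ` the antecedent chain of CMP-SW (up to the calibrated time clause) is
  inhabited (tree `Track.cmpTwoLoop_antecedents_inhabited`, through the landed TRACK stub p548356), so the prover's freedom F1 (`∃ φ`, chosen) offers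
  no vacuous discharge; lawful `φ` exist (`R3.exists_twoLoopLawH`).
Ordinary design lemmas; no verdict on CMP-SW, CMP-2LOOP or S-BASE (OPEN; the sketch proves `CMP-SW ∧ S-BASE ⟺ CMP-2LOOP ∧ S-BASE`).
-/

set_option autoImplicit false

noncomputable section

open MeasureTheory Filter Topology Real
open Literature.MathematicalPhysics.QuantumFieldTheory hiding SU2
open Literature.MathematicalPhysics.QuantumFieldTheory.Balaban1983to89
open scoped BigOperators

namespace Summit.QuantumFields.YangMills.Theorems.TwistedTraceScaling.Negative

open Summit.QuantumFields.YangMills.Theorems.FemtoTransferGap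
open Summit.QuantumFields.YangMills.Theorems.FemtoTransferGap.TraceDoor
open Summit.QuantumFields.YangMills.Theorems.FemtoTransferGap.TwoLattice

namespace R7

/-! ## CMP-SW: the conjunct `1 ≤ β₁` is removable, and the chosen calibrator offers no vacuous discharge -/

/-- ★ **In CMP-SW the conjunct `1 ≤ β₁ ∧` is removable**: the text of `…Sandwich.Stmt.cmpSandwich` (spelled with the tree abbreviations
`flowInvSq`, `calLambda`, `Stmt.twoLoopLawH`) and the same text with `1 ≤ β₁ ∧` deleted are EQUIVALENT (`←`: shrink `lam0` to
`min lam0 (1/(2(1+δ)))` and use `R3.one_le_beta1_of_calibrated`; `→`: weakening).  Design information, as support VI showed for CMP-2LOOP. [folklore] -/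
theorem cmpSandwich_iff_withoutBeta1GeOne :
    (∀ s : ℝ, 0 < s → ∀ ε : ℝ, 0 < ε → ∀ η : ℝ, 0 < η → ∃ M : ℕ, 2 ≤ M ∧ ∃ δ : ℝ, 0 < δ ∧
      ∃ φ : FlowStep.HBeta, Stmt.twoLoopLawH (B12Normalization.stepBal 2 M) (twoLoopStepBal M) φ ∧
        ∃ lam0 : ℝ, 0 < lam0 ∧ ∀ lam : ℝ, 0 < lam → lam ≤ lam0 →
          ∀ (L : ℕ) [NeZero L], M ^ 2 ≤ L → ∀ β : ℝ, InFemtoWindow lam β L →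
            ∀ (b k : ℕ) [NeZero b], M ≤ b → b < M ^ 2 → b * M ^ (k + 1) ≤ L → L < b * M ^ k * (M + 1) →
              1 / (4 * lam ^ 3) ≤ flowInvSq φ β (k + 1) →
                ∀ T : ℕ, |(T : ℝ) * calLambda φ β (k + 1) b / L - s| ≤ δ →
                  ∃ β₁ : ℝ, 1 ≤ β₁ ∧ |flowInvSq φ β (k + 1) - 2 * β₁| ≤ δ * (2 * β₁) ∧
                    ∃ n₁ n₂ : ℕ, |(n₁ : ℝ) * luscherLambda β₁ b / b - s| ≤ η ∧ |(n₂ : ℝ) * luscherLambda β₁ b / b - s| ≤ η ∧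
                      traceRatio b β₁ n₁ - ε ≤ traceRatio L β T ∧ traceRatio L β T ≤ traceRatio b β₁ n₂ + ε) ↔
    (∀ s : ℝ, 0 < s → ∀ ε : ℝ, 0 < ε → ∀ η : ℝ, 0 < η → ∃ M : ℕ, 2 ≤ M ∧ ∃ δ : ℝ, 0 < δ ∧
      ∃ φ : FlowStep.HBeta, Stmt.twoLoopLawH (B12Normalization.stepBal 2 M) (twoLoopStepBal M) φ ∧
        ∃ lam0 : ℝ, 0 < lam0 ∧ ∀ lam : ℝ, 0 < lam → lam ≤ lam0 →
          ∀ (L : ℕ) [NeZero L], M ^ 2 ≤ L → ∀ β : ℝ, InFemtoWindow lam β L →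
            ∀ (b k : ℕ) [NeZero b], M ≤ b → b < M ^ 2 → b * M ^ (k + 1) ≤ L → L < b * M ^ k * (M + 1) →
              1 / (4 * lam ^ 3) ≤ flowInvSq φ β (k + 1) →
                ∀ T : ℕ, |(T : ℝ) * calLambda φ β (k + 1) b / L - s| ≤ δ →
                  ∃ β₁ : ℝ, |flowInvSq φ β (k + 1) - 2 * β₁| ≤ δ * (2 * β₁) ∧
                    ∃ n₁ n₂ : ℕ, |(n₁ : ℝ) * luscherLambda β₁ b / b - s| ≤ η ∧ |(n₂ : ℝ) * luscherLambda β₁ b / b - s| ≤ η ∧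
                      traceRatio b β₁ n₁ - ε ≤ traceRatio L β T ∧ traceRatio L β T ≤ traceRatio b β₁ n₂ + ε) := by
  constructor
  · intro h s hs ε hε η hη
    obtain ⟨M, hM, δ, hδ, φ, hφ, lam0, hlam0, H1⟩ := h s hs ε hε η hη
    refine ⟨M, hM, δ, hδ, φ, hφ, lam0, hlam0, ?_⟩
    intro lam hlam hle L _ hL β hW b k _ hMb hbM hkL hLk hx T hT
    obtain ⟨β₁, -, hmis, n₁, n₂, h1, h2, h3, h4⟩ := H1 lam hlam hle L hL β hW b k hMb hbM hkL hLk hx T hT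
    exact ⟨β₁, hmis, n₁, n₂, h1, h2, h3, h4⟩
  · intro h s hs ε hε η hη
    obtain ⟨M, hM, δ, hδ, φ, hφ, lam0, hlam0, H1⟩ := h s hs ε hε η hη
    refine ⟨M, hM, δ, hδ, φ, hφ, min lam0 (1 / (2 * (1 + δ))), lt_min hlam0 (by positivity), ?_⟩
    intro lam hlam hle L _ hL β hW b k _ hMb hbM hkL hLk hx T hT
    obtain ⟨β₁, hmis, n₁, n₂, h1, h2, h3, h4⟩ :=
      H1 lam hlam (hle.trans (min_le_left _ _)) L hL β hW b k hMb hbM hkL hLk hx T hT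
    exact ⟨β₁, R3.one_le_beta1_of_calibrated hlam hδ (hle.trans (min_le_right _ _)) hx hmis, hmis, n₁, n₂, h1, h2, h3, h4⟩

/-- **CMP-SW's antecedent chain is inhabited for EVERY lawful calibrator** (`M ≥ 2`, `δ, s > 0`, any `φ` with the two-loop law, any `lam0 > 0`):
some `lam ≤ lam0`, fine lattice `L = M²` in the window, E1 base `(b, k) = (M, 0)`, calibrated value `x̂ ≥ 1/(4lam³)` and a time extent `T` in the
calibrated `δ`-band exist (tree `Track.cmpTwoLoop_antecedents_inhabited`, through the landed TRACK stub).  So a prover of CMP-SW cannot discharge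
it vacuously by its CHOICE of `φ` (freedom F1); lawful `φ` exist by `R3.exists_twoLoopLawH`. [folklore] -/
theorem cmpSandwich_antecedents_inhabited {M : ℕ} (hM : 2 ≤ M) {δ : ℝ} (hδ : 0 < δ) {s : ℝ} (hs : 0 < s)
    (φ : FlowStep.HBeta) (hφ : Stmt.twoLoopLawH (B12Normalization.stepBal 2 M) (twoLoopStepBal M) φ) {lam0 : ℝ} (hlam0 : 0 < lam0) :
    ∃ lam : ℝ, 0 < lam ∧ lam ≤ lam0 ∧ ∃ (L : ℕ) (_ : NeZero L), M ^ 2 ≤ L ∧ ∃ β : ℝ, InFemtoWindow lam β L ∧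
      ∃ (b k : ℕ) (_ : NeZero b), M ≤ b ∧ b < M ^ 2 ∧ b * M ^ (k + 1) ≤ L ∧ L < b * M ^ k * (M + 1) ∧
        1 / (4 * lam ^ 3) ≤ flowInvSq φ β (k + 1) ∧
        ∃ T : ℕ, |(T : ℝ) * calLambda φ β (k + 1) b / L - s| ≤ δ := by
  obtain ⟨lam, hlam, hle, L, iL, hL, β, hW, b, k, ib, h1, h2, h3, h4, hx, β₁, -, -, T, hT⟩ :=
    Track.cmpTwoLoop_antecedents_inhabited hM hδ hs φ hφ hlam0
  exact ⟨lam, hlam, hle, L, iL, hL, β, hW, b, k, ib, h1, h2, h3, h4, hx, T, hT⟩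

end R7

end Summit.QuantumFields.YangMills.Theorems.TwistedTraceScaling.Negative

end
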